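import Mathlib

/-!
# The valuation estimates of Lemma N5.L7 [A9] in kernel form

Kernel witnesses (Mathlib only) for the elementary valuation-theoretic steps of
Lemma N5.L7 of route/T5-route-2.md §N5.12.2 («the parameter of a dominant conjugate-orthogonal
character is an `F_v^×`-multiple of a deep unit»), the item of the N5 [A]-ledger that
`T5QuadraticInvolution` (the linear-algebra core) left as prose:

* the conductor bound: if an additive character `ψ` satisfies `ψ (t * x) = 1` for every `x` with
  `v x ≤ exp (-k)` (i.e. on `t · P^k`) and `ψ` is non-trivial on `P^{-n-1}`, then
  `v t ≤ exp (n + k)`, i.e. `t ∈ P^{-n-k}` (`le_of_trivial_of_not_trivial`,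
  `ord_le_of_trivial_of_not_trivial`) — the step «`tr(y) ∈ P_F^{-n_F - ⌈m/2⌉}`»;
* the integer bookkeeping `v_E(y₊) − v_E(y) ≥ m − C₀` with
  `C₀ = 1 + 2 n_F + 2 v_F(2) + v_E(δ) − d_v` (`arithmetic`);
* the ultrametric perturbation: `v a < v y` forces `v (y - a) = v y` and
  `y = (y - a) * (1 + u)` with `u = a / (y - a)`, `v u = v a / v y < 1`
  (`val_sub_eq_of_lt`, `eq_sub_mul_one_add`, `val_div_sub`);
* the valuation-defined higher unit groups `U(γ) = {x ∈ Kˣ | v (x - 1) ≤ γ}` (`γ < 1`) as subgroups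
  of `Kˣ`, and `1 + u ∈ U(γ)` for `v u ≤ γ` (`higherUnits`, `one_add_mem`);
* the factorisation `y = y₋ · w` with `w ∈ U(γ)` (`exists_mem_higherUnits_mul`) and the conclusion
  of the lemma, `δ / y ∈ F^× · U(γ)` whenever `δ / y₋ ∈ F^×` (`exists_mul_mem_of_div_mem`,
  `exists_mul_mem_of_div_mem_exp` in the additive bookkeeping of the lemma).

What stays prose: the definition of the parameter `c_γ` of a conjugate-orthogonal character
([FM21] (2.2)–(2.3)), `v_E = 2 v_F` on `F_v` at a ramified place, `y₊ = tr(y)/2 ∈ F_v`, and the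
statement `δ / y₋ ∈ F_v^×` (kernel-checked separately in `T5QuadraticInvolution`).

Uses an L-value-free non-vanishing device: NO (README §8(d)).
-/

namespace Summit.Ventures.HodgeRepro2.T5DominantParameter

open Valuation WithZero

section Perturbation

variable {K Γ₀ : Type*} [Field K] [LinearOrderedCommGroupWithZero Γ₀] (v : Valuation K Γ₀)

/-- Ultrametric inequality: subtracting an element of strictly smaller valuation does not change
the valuation («`v_E(y₋) = v_E(y)`»). -/
theorem val_sub_eq_of_lt {y a : K} (h : v a < v y) : v (y - a) = v y :=
  v.map_sub_eq_of_lt_left h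

/-- `v y ≠ 0` when some `v a < v y`. -/
theorem val_ne_zero_of_lt {y a : K} (h : v a < v y) : v y ≠ 0 :=
  (lt_of_le_of_lt zero_le h).ne'

/-- `y ≠ 0` when some `v a < v y`. -/
theorem ne_zero_of_lt {y a : K} (h : v a < v y) : y ≠ 0 :=
  v.ne_zero_iff.1 (val_ne_zero_of_lt v h)

/-- `y - a ≠ 0` when `v a < v y`. -/
theorem sub_ne_zero_of_lt {y a : K} (h : v a < v y) : y - a ≠ 0 :=
  v.ne_zero_iff.1 (by rw [val_sub_eq_of_lt v h]; exact val_ne_zero_of_lt v h)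

/-- The relative perturbation: `y = (y - a) * (1 + a / (y - a))` («`y = y₋ (1 + u)`,
`u = y₊ / y₋`»). -/
theorem eq_sub_mul_one_add {y a : K} (h : v a < v y) :
    y = (y - a) * (1 + a / (y - a)) := by
  have hne := sub_ne_zero_of_lt v h
  rw [mul_add, mul_one, mul_div_cancel₀ _ hne, sub_add_cancel]

/-- `v (a / (y - a)) = v a / v y`. -/
theorem val_div_sub {y a : K} (h : v a < v y) : v (a / (y - a)) = v a / v y := by
  rw [Valuation.map_div, val_sub_eq_of_lt v h]

/-- The relative perturbation has valuation `< 1`. -/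
theorem val_div_sub_lt_one {y a : K} (h : v a < v y) : v (a / (y - a)) < 1 := by
  rw [val_div_sub v h]
  exact (div_lt_one₀ (lt_of_le_of_lt zero_le h)).2 h

end Perturbation

section HigherUnits

variable {K Γ₀ : Type*} [Field K] [LinearOrderedCommGroupWithZero Γ₀] (v : Valuation K Γ₀)

/-- An element with `v (x - 1) < 1` has valuation `1`. -/
theorem val_eq_one_of_val_sub_one_lt {x : K} (h : v (x - 1) < 1) : v x = 1 := by
  have := v.map_one_add_of_lt h
  rwa [add_sub_cancel] at this

/-- The valuation-defined higher unit group `U(γ) = {x ∈ Kˣ | v (x - 1) ≤ γ}`, a subgroup of `Kˣ`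
for every `γ < 1` (for `γ = v ϖ ^ n`, `n ≥ 1`, this is `U_E^n`). -/
def higherUnits (γ : Γ₀) (hγ : γ < 1) : Subgroup Kˣ where
  carrier := {x : Kˣ | v ((x : K) - 1) ≤ γ}
  one_mem' := by simp
  mul_mem' := by
    intro x y hx hy
    simp only [Set.mem_setOf_eq, Units.val_mul] at hx hy ⊢
    have hx1 : v (x : K) = 1 := val_eq_one_of_val_sub_one_lt v (lt_of_le_of_lt hx hγ)
    have : (x : K) * y - 1 = (x : K) * (y - 1) + ((x : K) - 1) := by ring
    rw [this]
    refine v.map_add_le ?_ hx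
    rw [Valuation.map_mul, hx1, one_mul]
    exact hy
  inv_mem' := by
    intro x hx
    simp only [Set.mem_setOf_eq, Units.val_inv_eq_inv_val] at hx ⊢
    have hx0 : (x : K) ≠ 0 := x.ne_zero
    have hx1 : v (x : K) = 1 := val_eq_one_of_val_sub_one_lt v (lt_of_le_of_lt hx hγ)
    have : (x : K)⁻¹ - 1 = (x : K)⁻¹ * (1 - x) := by field_simp
    rw [this, Valuation.map_mul, Valuation.map_inv, hx1, inv_one, one_mul, v.map_sub_swap]
    exact hx

/-- Membership in `U(γ)`: `v (x - 1) ≤ γ`. -/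
theorem mem_higherUnits_iff {γ : Γ₀} {hγ : γ < 1} {x : Kˣ} :
    x ∈ higherUnits v γ hγ ↔ v ((x : K) - 1) ≤ γ :=
  Iff.rfl

/-- Elements of `U(γ)` have valuation `1`. -/
theorem val_eq_one_of_mem {γ : Γ₀} {hγ : γ < 1} {x : Kˣ} (hx : x ∈ higherUnits v γ hγ) :
    v (x : K) = 1 :=
  val_eq_one_of_val_sub_one_lt v (lt_of_le_of_lt hx hγ)

/-- The filtration is antitone: `U(γ) ≤ U(γ')` for `γ ≤ γ'`. -/
theorem higherUnits_mono {γ γ' : Γ₀} (hγ : γ < 1) (hγ' : γ' < 1) (h : γ ≤ γ') :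
    higherUnits v γ hγ ≤ higherUnits v γ' hγ' :=
  fun _ hx => le_trans hx h

/-- `1 + u` is a unit when `v u < 1`. -/
theorem one_add_ne_zero {u : K} (hu : v u < 1) : 1 + u ≠ 0 :=
  v.ne_zero_iff.1 (by rw [v.map_one_add_of_lt hu]; exact one_ne_zero)

/-- `1 + u ∈ U(γ)` when `v u ≤ γ` (`γ < 1`). -/
theorem one_add_mem {γ : Γ₀} (hγ : γ < 1) {u : K} (hu : v u ≤ γ) :
    Units.mk0 (1 + u) (one_add_ne_zero v (lt_of_le_of_lt hu hγ)) ∈ higherUnits v γ hγ := by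
  rw [mem_higherUnits_iff, Units.val_mk0, add_sub_cancel_left]
  exact hu

end HigherUnits

section Factorisation

variable {K Γ₀ : Type*} [Field K] [LinearOrderedCommGroupWithZero Γ₀] (v : Valuation K Γ₀)

/-- The factorisation of Lemma N5.L7: if `v a < v y` and `v a / v y ≤ γ < 1`, then
`y = (y - a) * w` with `w ∈ U(γ)` («`y = y₋ (1 + u)`, `1 + u ∈ U_E^{m - C₀}`»). -/
theorem exists_mem_higherUnits_mul {y a : K} (h : v a < v y) {γ : Γ₀} (hγ : γ < 1)
    (hle : v a / v y ≤ γ) :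
    ∃ w ∈ higherUnits v γ hγ, y = (y - a) * w := by
  have hu : v (a / (y - a)) ≤ γ := by rw [val_div_sub v h]; exact hle
  exact ⟨_, one_add_mem v hγ hu, by rw [Units.val_mk0]; exact eq_sub_mul_one_add v h⟩

/-- The conclusion of Lemma N5.L7: if `δ / (y - a)` lies in a subgroup `F ≤ Kˣ` («`δ / y₋ ∈ F_v^×`»,
`T5QuadraticInvolution`), then `δ / y = f * w` with `f ∈ F` and `w ∈ U(γ)`
(«`c_γ = δ / y ∈ F_v^× · U_E^{m - C₀}`»). -/
theorem exists_mul_mem_of_div_mem {F : Subgroup Kˣ} {δ y a : K} (h : v a < v y) {γ : Γ₀}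
    (hγ : γ < 1) (hle : v a / v y ≤ γ) (hF : ∃ f ∈ F, (f : K) = δ / (y - a)) :
    ∃ f ∈ F, ∃ w ∈ higherUnits v γ hγ, δ / y = (f : K) * w := by
  obtain ⟨w, hw, hyw⟩ := exists_mem_higherUnits_mul v h hγ hle
  obtain ⟨f, hf, hfe⟩ := hF
  refine ⟨f, hf, w⁻¹, (higherUnits v γ hγ).inv_mem hw, ?_⟩
  rw [hfe, Units.val_inv_eq_inv_val]
  calc δ / y = δ / ((y - a) * (w : K)) := by rw [← hyw]
    _ = δ / (y - a) * (w : K)⁻¹ := by rw [div_mul_eq_div_div, div_eq_mul_inv]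

end Factorisation

section Conductor

variable {K : Type*} [Field K] {M : Type*} [Monoid M] (v : Valuation K ℤᵐ⁰)

/-- Scaling a ball: `t * x ∈ ball (v t * γ)` iff `x ∈ ball γ` (`t ≠ 0`). -/
theorem mul_mem_leAddSubgroup_iff {t x : K} (ht : t ≠ 0) {γ : ℤᵐ⁰} :
    t * x ∈ v.leAddSubgroup (v t * γ) ↔ x ∈ v.leAddSubgroup γ := by
  simp only [mem_leAddSubgroup_iff, Valuation.map_mul]
  exact mul_le_mul_iff_right₀ (lt_of_le_of_ne zero_le (v.ne_zero_iff.2 ht).symm)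

/-- Every element of `ball (v t * γ)` is `t * x` with `x ∈ ball γ` («`t · P^k = P^{k + ord t}`»). -/
theorem exists_eq_mul_of_mem_leAddSubgroup {t z : K} (ht : t ≠ 0) {γ : ℤᵐ⁰}
    (hz : z ∈ v.leAddSubgroup (v t * γ)) : ∃ x ∈ v.leAddSubgroup γ, z = t * x := by
  refine ⟨z / t, ?_, (mul_div_cancel₀ z ht).symm⟩
  rw [← mul_mem_leAddSubgroup_iff v ht, mul_div_cancel₀ z ht]
  exact hz

/-- The conductor bound, valuation form: if `ψ (t * x) = 1` for every `x ∈ ball γ` and `ψ` is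
non-trivial on `ball γ₁`, then `v t * γ < γ₁`. -/
theorem val_mul_lt_of_trivial_of_not_trivial (ψ : AddChar K M) {t : K} (ht : t ≠ 0) {γ γ₁ : ℤᵐ⁰}
    (htriv : ∀ x, v x ≤ γ → ψ (t * x) = 1) (hnt : ∃ z, v z ≤ γ₁ ∧ ψ z ≠ 1) :
    v t * γ < γ₁ := by
  by_contra hle
  rw [not_lt] at hle
  obtain ⟨z, hz, hψ⟩ := hnt
  obtain ⟨x, hx, rfl⟩ := exists_eq_mul_of_mem_leAddSubgroup v ht
    (show z ∈ v.leAddSubgroup (v t * γ) from le_trans hz hle)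
  exact hψ (htriv x hx)

/-- The conductor bound in the additive bookkeeping of Lemma N5.L7: with `v t = exp (-j)`
(«`ord t = j`»), `ψ (t * x) = 1` for all `x ∈ P^k` («`v x ≤ exp (-k)`») and `ψ` non-trivial on
`P^{-n-1}` («`v z ≤ exp (n + 1)`», `n` the conductor of `ψ`), one has `-n - k ≤ j`, i.e.
`t ∈ P^{-n-k}` («`tr(y) ∈ P_F^{-n_F - ⌈m/2⌉}`»). -/
theorem ord_le_of_trivial_of_not_trivial (ψ : AddChar K M) {t : K} (ht : t ≠ 0) {j k n : ℤ}
    (hvt : v t = exp (-j)) (htriv : ∀ x, v x ≤ exp (-k) → ψ (t * x) = 1)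
    (hnt : ∃ z, v z ≤ exp (n + 1) ∧ ψ z ≠ 1) : -n - k ≤ j := by
  have h := val_mul_lt_of_trivial_of_not_trivial v ψ ht htriv hnt
  rw [hvt, ← exp_add, exp_lt_exp] at h
  omega

/-- The same bound stated on the valuation: `v t ≤ exp (n + k)`. -/
theorem le_of_trivial_of_not_trivial (ψ : AddChar K M) {t : K} (ht : t ≠ 0) {k n : ℤ}
    (htriv : ∀ x, v x ≤ exp (-k) → ψ (t * x) = 1)
    (hnt : ∃ z, v z ≤ exp (n + 1) ∧ ψ z ≠ 1) : v t ≤ exp (n + k) := by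
  obtain ⟨j, hj⟩ : ∃ j : ℤ, v t = exp (-j) :=
    ⟨-log (v t), by rw [neg_neg, exp_log (v.ne_zero_iff.2 ht)]⟩
  have := ord_le_of_trivial_of_not_trivial v ψ ht hj htriv hnt
  rw [hj, exp_le_exp]
  omega

end Conductor

section Arithmetic

/-- The integer bookkeeping of Lemma N5.L7: with `c = ⌈m/2⌉` (so `2 c ≤ m + 1`),
`v_F(y₊) ≥ -n_F - c - v_F(2)`, `v_E(y₊) = 2 v_F(y₊)` and `v_E(y) = v_E(δ) - 2 m - d_v`, one has
`v_E(y₊) - v_E(y) ≥ m - C₀` with `C₀ = 1 + 2 n_F + 2 v_F(2) + v_E(δ) - d_v`. -/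
theorem arithmetic {nF v2 vδ d m c w : ℤ} (hc : 2 * c ≤ m + 1) (hw : -nF - c - v2 ≤ w) :
    m - (1 + 2 * nF + 2 * v2 + vδ - d) ≤ 2 * w - (vδ - 2 * m - d) := by
  omega

/-- `⌈m/2⌉` in the form used: `c = (m + 1) / 2` satisfies `m ≤ 2 c ≤ m + 1`. -/
theorem ceil_half_spec (m : ℤ) : m ≤ 2 * ((m + 1) / 2) ∧ 2 * ((m + 1) / 2) ≤ m + 1 := by
  omega

end Arithmetic

section Assembly

variable {K : Type*} [Field K] (v : Valuation K ℤᵐ⁰)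

/-- From additive data to the multiplicative hypotheses: `v a = exp (-p)`, `v y = exp (-q)` and
`p - q ≥ r > 0` give `v a < v y` and `v a / v y ≤ exp (-r)`. -/
theorem lt_and_div_le_of_exp {a y : K} {p q r : ℤ} (ha : v a = exp (-p)) (hy : v y = exp (-q))
    (hr : 0 < r) (hpq : r ≤ p - q) :
    v a < v y ∧ v a / v y ≤ exp (-r) ∧ exp (-r) < (1 : ℤᵐ⁰) := by
  refine ⟨?_, ?_, ?_⟩
  · rw [ha, hy, exp_lt_exp]; omega
  · rw [ha, hy, ← exp_sub, exp_le_exp]; omega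
  · rw [← exp_zero, exp_lt_exp]; omega

/-- Lemma N5.L7 assembled in the additive bookkeeping: if `v y₊ = exp (-(2 w))`
(«`v_E(y₊) = 2 v_F(y₊)`»), `w ≥ -n_F - c - v_F(2)`, `2 c ≤ m + 1`,
`v y = exp (-(v_E(δ) - 2 m - d_v))`, `m > C₀` and `δ / (y - y₊) ∈ F`, then
`δ / y = f * u` with `f ∈ F` and `u ∈ U(exp (-(m - C₀)))`. -/
theorem exists_mul_mem_of_div_mem_exp {F : Subgroup Kˣ} {δ y yplus : K}
    {nF v2 vδ d m c w : ℤ} (hc : 2 * c ≤ m + 1) (hw : -nF - c - v2 ≤ w)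
    (hyplus : v yplus = exp (-(2 * w))) (hy : v y = exp (-(vδ - 2 * m - d)))
    (hm : 1 + 2 * nF + 2 * v2 + vδ - d < m) (hF : ∃ f ∈ F, (f : K) = δ / (y - yplus)) :
    ∃ f ∈ F, ∃ u ∈ higherUnits v (exp (-(m - (1 + 2 * nF + 2 * v2 + vδ - d))))
      (by rw [← exp_zero, exp_lt_exp]; omega), δ / y = (f : K) * u := by
  obtain ⟨hlt, hle, _⟩ := lt_and_div_le_of_exp v hyplus hy (r := m - (1 + 2 * nF + 2 * v2 + vδ - d))
    (by omega) (by have := arithmetic hc hw (vδ := vδ) (d := d) (m := m); omega)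
  exact exists_mul_mem_of_div_mem v hlt _ hle hF

end Assembly

end Summit.Ventures.HodgeRepro2.T5DominantParameter
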